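import Literature.NumberTheory.EllipticCurves.TateCurve.Invariants
import Literature.NumberTheory.EllipticCurves.TateCurve.UniformizationLevelDifference
import Literature.NumberTheory.EllipticCurves.TateCurve.UniformizationLevelMatching
import HarnessLib

/-!
# Silverman ATAEC §V.4, surjectivity off `E_{q,0}`: every point with `|x| < 1` has a
# level partner `φ(u)`, `|q| < |u| < 1`, with `x(P − φ(u))` integral (block A, assembled)

J. H. Silverman, *Advanced Topics in the Arithmetic of Elliptic Curves*, GTM 151, §V.4, proof of
Thm. V.3.1 (c) (surjectivity) via Prop. 4.1 and Lemmas 4.1.2, 4.1.4, PDF pp. 400–405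
[cite: SilvermanATAEC1994, Lemma V.4.1.4 (PDF p. 404)].  The print counts cosets
("`#E_q(K)/E_{q,0}(K) ≤ ord_v q`"); the uniformiser-free route of this programme (split with
abc-iut-L2-t5 / abc-iut-L6-t5) is LEVEL MATCHING: for a point `P = (x, y)` of
`E_q : y² + xy = x³ + a₄(q)x + a₆(q)` with `‖x‖ < 1` (i.e. `P ∉ E_{q,0}`), Lemma 4.1.2
(`levels_of_norm_lt_one`) puts `P` in a class `U_r`, `V_r` (`r² > ‖q‖`) or `W`; the level-matching
estimates (`tate_mem_U/V/W`) produce `u` in the fundamental annulus `‖q‖ < ‖u‖ < 1` with `φ(u) =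
(X(u,q), Y(u,q))` in the same class (for `U` one uses `φ(q·y⁻¹) = φ(y⁻¹) = −φ(y)`), and Lemma 4.1.4
(`one_le_norm_subX_of_U/V/W`) gives: either `x = X(u,q)` (so `P = ±φ(u) = φ(u^{±1})`), or the
`x`-coordinate `λ² + λ − x − X(u)`, `λ = (y + Y(u) + X(u))/(x − X(u))`, of `P − φ(u)` has norm
`≥ 1`, i.e. `P − φ(u) ∈ E_{q,0}(K)` — `exists_partner_of_norm_lt_one`.  Combined with
`φ(O_K^×) = E_{q,0}(K)` (block B) and the homomorphism property this is the surjectivity of `φ`.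
Also: `‖a₆(q)‖ = ‖q‖` exactly (`norm_tateA6_eq`, from the integral expansion `a₆ = −q − 9q² − …`),
and elements of the open fundamental annulus are not in `q^ℤ` (`ne_zpow_of_norm_lt_of_lt`).
Complete ultrametric field, `12` invertible, `0 < ‖q‖ < 1`; no discreteness.  Classical.
Seat abc-iut-L2-t6.
-/

noncomputable section

open scoped ArithmeticFunction.sigma

namespace Literature.NumberTheory.EllipticCurves.TateCurve

open SteinWuthrich2013 Filter Topology IsUltrametricDist

variable {K : Type*} [NontriviallyNormedField K] [CompleteSpace K] [IsUltrametricDist K] {q x y : K}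

/-! ### `‖a₆(q)‖ = ‖q‖` -/

omit [CompleteSpace K] [IsUltrametricDist K] in
/-- The first coefficient of `−a₆(q)` is `a6Coeff 1 = (5 + 7)/12 = 1`.
[cite: SilvermanATAEC1994, Ch. V §1 (1.1)(b)] -/
theorem a6Coeff_one : a6Coeff 1 = 1 := by
  simp [a6Coeff, ArithmeticFunction.sigma_one]

/-- `‖a₆(q) + q‖ ≤ ‖q‖²`: `a₆(q) = −q − Σ_{n≥2} a6Coeff(n) qⁿ` with integer coefficients.
[cite: SilvermanATAEC1994, Ch. V §1 (1.1)(b)] -/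
theorem norm_tateA6_add_le (hq : ‖q‖ < 1) (h12 : (12 : K) ≠ 0) : ‖tateA6 q + q‖ ≤ ‖q‖ ^ 2 := by
  have hS : Summable fun n : ℕ => (a6Coeff (n + 1) : K) * q ^ (n + 1) := by
    refine Summable.of_norm_bounded (g := fun n : ℕ => ‖q‖ ^ (n + 1)) ?_ fun n => ?_
    · exact (summable_geometric_of_lt_one (norm_nonneg q) hq).mul_right ‖q‖ |>.congr
        fun n => by ring
    · rw [norm_mul, norm_pow]
      exact mul_le_of_le_one_left (pow_nonneg (norm_nonneg _) _) (norm_intCast_le_one K _)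
  have hsplit := hS.tsum_eq_zero_add
  have h0 : (a6Coeff (0 + 1) : K) * q ^ (0 + 1) = q := by
    rw [zero_add, a6Coeff_one, Int.cast_one, one_mul, pow_one]
  have hA : tateA6 q + q = -∑' n : ℕ, (a6Coeff (n + 1 + 1) : K) * q ^ (n + 1 + 1) := by
    rw [tateA6_eq_tsum hq h12, hsplit, h0]; ring
  rw [hA, norm_neg]
  refine norm_tsum_le_of_forall_le_of_nonneg (sq_nonneg _) fun n => ?_
  rw [norm_mul, norm_pow]
  calc ‖(a6Coeff (n + 1 + 1) : K)‖ * ‖q‖ ^ (n + 1 + 1) ≤ 1 * ‖q‖ ^ (n + 2) :=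
        mul_le_mul_of_nonneg_right (norm_intCast_le_one K _) (pow_nonneg (norm_nonneg _) _)
    _ ≤ ‖q‖ ^ 2 := by
        rw [one_mul, pow_add]
        exact mul_le_of_le_one_left (sq_nonneg _) (pow_le_one₀ (norm_nonneg _) hq.le)

/-- **`‖a₆(q)‖ = ‖q‖`** for `0 < ‖q‖ < 1` (`12` invertible): the term `−q` dominates.
[cite: SilvermanATAEC1994, Ch. V §1 (1.1)(b)] -/
theorem norm_tateA6_eq (hq0 : q ≠ 0) (hq : ‖q‖ < 1) (h12 : (12 : K) ≠ 0) : ‖tateA6 q‖ = ‖q‖ := by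
  have hqpos : 0 < ‖q‖ := norm_pos_iff.mpr hq0
  have hlt : ‖tateA6 q + q‖ < ‖-q‖ := by
    rw [norm_neg]
    refine lt_of_le_of_lt (norm_tateA6_add_le hq h12) ?_
    calc ‖q‖ ^ 2 = ‖q‖ * ‖q‖ := sq _
      _ < ‖q‖ * 1 := mul_lt_mul_of_pos_left hq hqpos
      _ = ‖q‖ := mul_one _
  have h : tateA6 q = (tateA6 q + q) + -q := by ring
  rw [h, norm_add_eq_max_of_norm_ne_norm (ne_of_lt hlt), max_eq_right hlt.le, norm_neg]

/-! ### The open fundamental annulus misses `q^ℤ` -/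

omit [CompleteSpace K] [IsUltrametricDist K] in
/-- An element with `‖q‖ < ‖u‖ < 1` is not an integral power of `q`.
[cite: SilvermanATAEC1994, Lemma V.4.1.2 (PDF p. 403)] -/
theorem ne_zpow_of_norm_lt_of_lt {u : K} (hqu : ‖q‖ < ‖u‖) (hu1 : ‖u‖ < 1) (n : ℤ) :
    u ≠ q ^ n := by
  intro h
  have hq1 : ‖q‖ < 1 := hqu.trans hu1
  rcases eq_or_ne q 0 with rfl | hq0
  · rcases eq_or_ne n 0 with rfl | hn0
    · rw [zpow_zero] at h
      rw [h, norm_one] at hu1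
      exact lt_irrefl _ hu1
    · rw [zero_zpow n hn0] at h
      rw [h] at hqu
      exact lt_irrefl _ hqu
  · have hpos : 0 < ‖q‖ := norm_pos_iff.mpr hq0
    rw [h, norm_zpow] at hqu hu1
    rcases le_or_gt n 0 with hn | hn
    · have : 1 ≤ ‖q‖ ^ n := one_le_zpow_of_nonpos₀ hpos hq1.le hn
      linarith
    · have : ‖q‖ ^ n ≤ ‖q‖ ^ (1 : ℤ) := zpow_le_zpow_right_of_le_one₀ hpos hq1.le (by omega)
      rw [zpow_one] at this
      linarith

/-! ### The level partner -/

/-- **Every point off `E_{q,0}` has a level partner in `φ` of the fundamental annulus.**  For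
`P = (x, y)` on `E_q` with `‖x‖ < 1` there is `u` with `‖q‖ < ‖u‖ < 1` such that either
`x = X(u,q)` (then `P = ±φ(u)`), or the `x`-coordinate of `P − φ(u)` (chord formula,
`φ(u) = (X(u,q), Y(u,q))`) has norm `≥ 1`, i.e. `P − φ(u) ∈ E_{q,0}(K)`.  The hypothesis `hon`
is V.3.1 (c) "`φ(u) ∈ E_q`" on the annulus (`TateFormalIdentity.tate_onCurve`, abc-iut-L2-t5).
[cite: SilvermanATAEC1994, Lemma V.4.1.4 (PDF p. 404)] -/
theorem exists_partner_of_norm_lt_one (h12 : (12 : K) ≠ 0) (hq0 : q ≠ 0) (hq : ‖q‖ < 1)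
    (hon : ∀ u : K, ‖q‖ < ‖u‖ → ‖u‖ < 1 →
      tateY q u ^ 2 + tateX q u * tateY q u = tateX q u ^ 3 + tateA4 q * tateX q u + tateA6 q)
    (heq : y ^ 2 + x * y = x ^ 3 + tateA4 q * x + tateA6 q) (hx : ‖x‖ < 1) :
    ∃ u : K, ‖q‖ < ‖u‖ ∧ ‖u‖ < 1 ∧ (x = tateX q u ∨
      1 ≤ ‖((y + tateY q u + tateX q u) / (x - tateX q u)) ^ 2
            + (y + tateY q u + tateX q u) / (x - tateX q u) - x - tateX q u‖) := by
  have hqpos : 0 < ‖q‖ := norm_pos_iff.mpr hq0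
  have ha4 : ‖tateA4 q‖ ≤ ‖q‖ := norm_tateA4_le hq.le
  have ha6 : ‖tateA6 q‖ = ‖q‖ := norm_tateA6_eq hq0 hq h12
  have hy1 : ‖y‖ < 1 := by
    by_contra h
    have := (one_le_norm_x_iff heq (lt_of_le_of_lt ha4 hq) (ha6 ▸ hq)).mpr (not_lt.mp h)
    linarith
  rcases levels_of_norm_lt_one heq ha4 ha6 hq hx with ⟨hU, hlev⟩ | ⟨hV, hlev⟩ | ⟨hWy, hWxy⟩
  · -- class `U`, level `r = ‖y‖`: partner `u = q·y⁻¹` (`φ(q y⁻¹) = φ(y⁻¹) = −φ(y)`)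
    have hr0 : 0 < ‖y‖ := norm_pos_of_lt_sq (norm_nonneg q) hlev
    have hy0 : y ≠ 0 := norm_pos_iff.mp hr0
    have hqr : ‖q‖ < ‖y‖ := lt_of_lt_of_le hlev (by nlinarith)
    obtain ⟨hU', hlev'⟩ := tate_mem_U hq hy1 hlev
    refine ⟨q * y⁻¹, ?_, ?_, ?_⟩
    · rw [norm_mul, norm_inv]
      calc ‖q‖ = ‖q‖ * ‖y‖⁻¹ * ‖y‖ := by field_simp
        _ < ‖q‖ * ‖y‖⁻¹ * 1 := by
            apply mul_lt_mul_of_pos_left hy1; positivity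
        _ = ‖q‖ * ‖y‖⁻¹ := mul_one _
    · rw [norm_mul, norm_inv, mul_inv_lt_iff₀ hr0, one_mul]; exact hqr
    · rw [tateX_mul_left hq0, tateY_mul_left hq0]
      by_cases hxX : x = tateX q y⁻¹
      · exact Or.inl hxX
      · right
        refine one_le_norm_subX_of_U hU ?_ ?_ hy1 hxX
        · rwa [add_comm] at hU' ⊢
        · exact hlev'.symm
  · -- class `V`, level `r = ‖x + y‖`: partner `u = x + y`
    have hr1 : ‖x + y‖ < 1 := lt_of_le_of_lt (norm_add_le_max _ _) (max_lt hx hy1)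
    have hqr : ‖q‖ < ‖x + y‖ := lt_of_lt_of_le hlev (by nlinarith [norm_nonneg (x + y)])
    obtain ⟨hV', hlev'⟩ := tate_mem_V hq hr1 hlev
    refine ⟨x + y, hqr, hr1, ?_⟩
    by_cases hxX : x = tateX q (x + y)
    · exact Or.inl hxX
    · exact Or.inr (one_le_norm_subX_of_V hV hV' hlev'.symm hr1 hxX)
  · -- class `W`: partner `u = y`, `‖y‖² = ‖q‖`
    have hr0 : 0 < ‖y‖ := norm_pos_of_lt_sq le_rfl (hWy.symm ▸ hqpos)
    have hqr : ‖q‖ < ‖y‖ := by rw [← hWy]; nlinarith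
    obtain ⟨hY', hXY'⟩ := tate_mem_W hq hq0 hWy
    refine ⟨y, hqr, hy1, ?_⟩
    by_cases hxX : x = tateX q y
    · exact Or.inl hxX
    · exact Or.inr (one_le_norm_subX_of_W heq (hon y hqr hy1) ha4 hq hWy hWxy hY' hXY' hxX)

/-! ### From the `x`-coordinate to the point: the dichotomy form -/

omit [CompleteSpace K] [IsUltrametricDist K] in
/-- Two points of `y² + xy = x³ + a₄x + a₆` with the same `x` are `P` and `±P`:
`y' = y` or `y' = −y − x`. [cite: SilvermanATAEC1994, Lemma V.4.1.4 (PDF p. 404)] -/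
theorem eq_or_eq_neg_of_weierstrass {x y y' c : K} (h : y ^ 2 + x * y = c)
    (h' : y' ^ 2 + x * y' = c) : y' = y ∨ y' = -y - x := by
  have hmul : (y' - y) * (y' + y + x) = 0 := by
    have : (y' - y) * (y' + y + x) = (y' ^ 2 + x * y') - (y ^ 2 + x * y) := by ring
    rw [this, h, h', sub_self]
  rcases mul_eq_zero.mp hmul with h1 | h2
  · exact Or.inl (sub_eq_zero.mp h1)
  · right; linear_combination h2

/-- **Dichotomy form of the level partner.**  For `P = (x, y)` on `E_q` with `‖x‖ < 1` there is
`u` in the fundamental annulus `‖q‖ < ‖u‖ < 1` with EITHER `P = φ(u)` on the nose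
(`x = X(u,q)`, `y = Y(u,q)`; the sign is absorbed by `−φ(u) = φ(u⁻¹) = φ(q u⁻¹)`, `q u⁻¹` again in
the annulus) OR `‖x(P − φ(u))‖ ≥ 1`. [cite: SilvermanATAEC1994, Lemma V.4.1.4 (PDF p. 404)] -/
theorem exists_partner_dichotomy (h12 : (12 : K) ≠ 0) (hq0 : q ≠ 0) (hq : ‖q‖ < 1)
    (hon : ∀ u : K, ‖q‖ < ‖u‖ → ‖u‖ < 1 →
      tateY q u ^ 2 + tateX q u * tateY q u = tateX q u ^ 3 + tateA4 q * tateX q u + tateA6 q)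
    (heq : y ^ 2 + x * y = x ^ 3 + tateA4 q * x + tateA6 q) (hx : ‖x‖ < 1) :
    ∃ u : K, ‖q‖ < ‖u‖ ∧ ‖u‖ < 1 ∧ ((x = tateX q u ∧ y = tateY q u) ∨
      1 ≤ ‖((y + tateY q u + tateX q u) / (x - tateX q u)) ^ 2
            + (y + tateY q u + tateX q u) / (x - tateX q u) - x - tateX q u‖) := by
  obtain ⟨u, hqu, hu1, h⟩ := exists_partner_of_norm_lt_one h12 hq0 hq hon heq hx
  rcases h with hxX | hchord
  · -- same `x`: `y = Y(u)` or `y = -Y(u) - X(u) = Y(q u⁻¹)`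
    have honu := hon u hqu hu1
    rw [← hxX] at honu
    rcases eq_or_eq_neg_of_weierstrass honu heq with hy | hy
    · exact ⟨u, hqu, hu1, Or.inl ⟨hxX, hy⟩⟩
    · have hu0 : 0 < ‖u‖ := lt_of_le_of_lt (norm_nonneg q) hqu
      have hqpos : 0 < ‖q‖ := norm_pos_iff.mpr hq0
      refine ⟨q * u⁻¹, ?_, ?_, Or.inl ⟨?_, ?_⟩⟩
      · rw [norm_mul, norm_inv]
        calc ‖q‖ = ‖q‖ * ‖u‖⁻¹ * ‖u‖ := by field_simp
          _ < ‖q‖ * ‖u‖⁻¹ * 1 := by apply mul_lt_mul_of_pos_left hu1; positivity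
          _ = ‖q‖ * ‖u‖⁻¹ := mul_one _
      · rw [norm_mul, norm_inv, mul_inv_lt_iff₀ hu0, one_mul]; exact hqu
      · rw [tateX_mul_left hq0, tateX_inv, hxX]
      · rw [tateY_mul_left hq0, tateY_inv hq, hy, hxX]
  · exact ⟨u, hqu, hu1, Or.inr hchord⟩

end Literature.NumberTheory.EllipticCurves.TateCurve

end
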